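import Literature.AlgebraicGeometry.Frobenioids.CoAngular
import Literature.AlgebraicGeometry.Frobenioids.BiratSubfunctor
import Literature.AlgebraicGeometry.Frobenioids.BiratUnitsDiv
import HarnessLib

/-!
# Frobenioids I: the birational germs of a Frobenioid exhaust `Φ^birat` at base objects

Mochizuki, *The geometry of Frobenioids I: the general theory*, Kyushu J. Math. **62** (2008)
293–400, Proposition 4.4 (iii)/(iv) p. 83 and the proof of Theorem 5.1 (i), pp. 97–99
[cite: MochizukiFrdI2008, Prop. 4.4 (iii) p.83] [cite: MochizukiFrdI2008, Thm. 5.1 (i) p.97].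

`BiratSubfunctor.lean` (abc-iut-L1-t5) defines the concrete `Φ^birat ⊆ Φ^gp` of a pre-Frobenioid
`F : C → F_Φ` as the subfunctor of groups GENERATED by the *birational germs*
`Φ(δ₁)⁻¹(Div δ₁) − Φ(δ₂)⁻¹(Div δ₂)` of pairs of base-equivalent pre-steps `δ₁, δ₂ : Y → A`, pulled back
along all morphisms of `D`. The proof of Theorem 5.1 (i) (p. 97 ll. 41–44) reads membership in
`Φ^birat(A)` as "there EXISTS a pair of base-equivalent pre-steps `δ₁, δ₂ : D → A` such that …", i.e. it
uses that at a base object `A_D = Base(A)` every element of `Φ^birat(A_D)` is a SINGLE germ at `A` — the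
content of Proposition 4.4 (iii)/(iv) ("a surjection `O^×(A^birat) ↠ Φ^birat(A^birat)`") for this concrete
subfunctor. This file proves exactly that, for a Frobenioid of isotropic type
(`mem_biratGerms_of_mem_biratSubfunctor`): the germs at `A` contain `1`, are closed under inverses and
products (common refinement of two pairs of pre-steps by Definition 1.3 (iii)(d)), and contain every
pulled-back germ `Φ(f)(d)`, `f : A_D → Base(A')` (lift `f` to a pull-back morphism by Definition 1.3
(i)(c), transport the pair of pre-steps along it by the universal property of pull-back morphisms, and
move between base-isomorphic objects through the pair of pre-steps of Definition 1.3 (i)(b)).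
(`RatFrac.invDiv_congr` is imported from `BiratUnitsDiv.lean`, abc-iut-L6-t8.) Everything is a theorem; the divisor bookkeeping is Remark 1.1.1. Isotropy is used only to make
pre-steps co-angular (Proposition 1.4 (i)), as Definition 1.3 (iii)(d) requires.
-/

namespace Literature.AlgebraicGeometry.Frobenioids

open CategoryTheory Opposite

universe w v v' u u'

namespace PreFrobenioid

variable {D : Type u} [Category.{v} D] {Φ : Dᵒᵖ ⥤ CommMonCat.{w}}
  {C : Type u'} [Category.{v'} C] (F : C ⥤ ElemFrobenioid Φ)

/-! ### Pull-back bookkeeping along isomorphisms of `D` -/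

section Pull

variable {F}

/-- `(f⁻¹)^* ∘ f^* = id` on `Φ`. [cite: MochizukiFrdI2008, Def. 1.1(ii)] -/
theorem pull_inv_pull_eq {X Y : D} (f : X ⟶ Y) [IsIso f] (y : Φ.obj (op Y)) :
    pull Φ (inv f) (pull Φ f y) = y := by
  rw [← pull_comp, IsIso.inv_hom_id, pull_id]

/-- `f^* ∘ (f⁻¹)^* = id` on `Φ`. [cite: MochizukiFrdI2008, Def. 1.1(ii)] -/
theorem pull_pull_inv_eq {X Y : D} (f : X ⟶ Y) [IsIso f] (x : Φ.obj (op X)) :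
    pull Φ f (pull Φ (inv f) x) = x := by
  rw [← pull_comp, IsIso.hom_inv_id, pull_id]

/-- Pull-back along an isomorphism of `D` is injective. [cite: MochizukiFrdI2008, Def. 1.1(ii)] -/
theorem pull_injective {X Y : D} (f : X ⟶ Y) [IsIso f] : Function.Injective (pull Φ f) :=
  fun a b h => by simpa only [pull_inv_pull_eq] using congrArg (pull Φ (inv f)) h

/-- `Φ(f)` on `Φ^gp` extends `f^*` on `Φ`. [cite: MochizukiFrdI2008, Def. 1.1(ii)] -/
theorem pullGp_of' {X Y : D} (f : X ⟶ Y) (a : Φ.obj (op Y)) :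
    pullGp Φ f (Algebra.GrothendieckGroup.of a) = Algebra.GrothendieckGroup.of (pull Φ f a) :=
  pullGp_of f a

/-- `Φ(f⁻¹) ∘ Φ(f) = id` on `Φ^gp`. [cite: MochizukiFrdI2008, Def. 1.1(ii)] -/
theorem pullGp_inv_pullGp {X Y : D} (f : X ⟶ Y) [IsIso f]
    (c : Algebra.GrothendieckGroup (Φ.obj (op Y))) : pullGp Φ (inv f) (pullGp Φ f c) = c := by
  rw [← pullGp_comp, IsIso.inv_hom_id, pullGp_id]

/-- `Φ(f) ∘ Φ(f⁻¹) = id` on `Φ^gp`. [cite: MochizukiFrdI2008, Def. 1.1(ii)] -/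
theorem pullGp_pullGp_inv {X Y : D} (f : X ⟶ Y) [IsIso f]
    (c : Algebra.GrothendieckGroup (Φ.obj (op X))) : pullGp Φ f (pullGp Φ (inv f) c) = c := by
  rw [← pullGp_comp, IsIso.hom_inv_id, pullGp_id]

/-- `Φ(f)` is injective on `Φ^gp` for an isomorphism `f`. [cite: MochizukiFrdI2008, Def. 1.1(ii)] -/
theorem pullGp_injective {X Y : D} (f : X ⟶ Y) [IsIso f] :
    Function.Injective (pullGp Φ f) :=
  fun a b h => by simpa only [pullGp_inv_pullGp] using congrArg (pullGp Φ (inv f)) h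

end Pull

/-- A linear morphism has `deg_Fr = 1` as a natural number. [cite: MochizukiFrdI2008, Def. 1.2(i)] -/
theorem degFr_coe_eq_one {A B : C} {δ : A ⟶ B} (h : IsLinear F δ) : (degFr F δ : ℕ) = 1 := by
  rw [show degFr F δ = 1 from h]; rfl

/-! ### Divisor bookkeeping for composites of base-isomorphisms (Remark 1.1.1) -/

/-- For a base-isomorphism `a : W → Y` and a pre-step `δ : Y → A`:
`Φ(δ)((Φ(δ ∘ a))⁻¹ Div(δ ∘ a)) = Div(δ) + Φ(a)⁻¹ Div(a)` (Remark 1.1.1 with `deg_Fr(δ) = 1`).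
[cite: MochizukiFrdI2008, Rem. 1.1.1] -/
theorem pull_invDiv_comp {W Y A : C} (a : W ⟶ Y) (δ : Y ⟶ A) (ha : IsBaseIso F a)
    (hδ : IsPreStep F δ) (h : IsBaseIso F (a ≫ δ)) :
    pull Φ (Base F δ) (invDiv F (a ≫ δ) h) = Div F δ * invDiv F a ha := by
  haveI : IsIso (Base F (a ≫ δ)) := h
  haveI : IsIso (Base F δ) := hδ.2
  haveI : IsIso (Base F a) := ha
  apply pull_injective (Base F a)
  rw [← pull_comp, ← base_comp, pull_invDiv, map_mul, pull_invDiv, div_comp,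
    degFr_coe_eq_one F hδ.1, pow_one]

/-- The birational germ of a pair of base-equivalent pre-steps `δ₁, δ₂ : Y → A` is unchanged by
precomposition with a base-isomorphism `a : W → Y` (first paragraph of the proof of Thm. 5.1 (i),
p. 97: "such replacements do not affect the element … determined by the `A`-pair").
[cite: MochizukiFrdI2008, Thm. 5.1 (i) p.97] -/
theorem germ_comp_eq {W Y A : C} (a : W ⟶ Y) (δ₁ δ₂ : Y ⟶ A) (ha : IsBaseIso F a)
    (h₁ : IsPreStep F δ₁) (h₂ : IsPreStep F δ₂) (hb : BaseEquivalent F δ₁ δ₂)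
    (h₁' : IsBaseIso F (a ≫ δ₁)) (h₂' : IsBaseIso F (a ≫ δ₂)) :
    Algebra.GrothendieckGroup.of (invDiv F (a ≫ δ₁) h₁') /
        Algebra.GrothendieckGroup.of (invDiv F (a ≫ δ₂) h₂') =
      Algebra.GrothendieckGroup.of (invDiv F δ₁ h₁.2) /
        Algebra.GrothendieckGroup.of (invDiv F δ₂ h₂.2) := by
  haveI : IsIso (Base F δ₁) := h₁.2
  apply pullGp_injective (Base F δ₁)
  rw [map_div, map_div, pullGp_of', pullGp_of', pullGp_of', pullGp_of', pull_invDiv_comp F a δ₁ ha h₁,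
    pull_invDiv]
  have e₂ : pull Φ (Base F δ₁) (invDiv F (a ≫ δ₂) h₂') = Div F δ₂ * invDiv F a ha := by
    rw [show Base F δ₁ = Base F δ₂ from hb]; exact pull_invDiv_comp F a δ₂ ha h₂ h₂'
  have e₂' : pull Φ (Base F δ₁) (invDiv F δ₂ h₂.2) = Div F δ₂ := by
    rw [show Base F δ₁ = Base F δ₂ from hb]; exact pull_invDiv δ₂ h₂.2
  rw [e₂, e₂', map_mul, map_mul, mul_div_mul_right_eq_div]

/-! ### Germs: elementary closure properties -/

variable {F} in
/-- In a Frobenioid of isotropic type every pre-step is a co-angular pre-step (Prop. 1.4 (i)).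
[cite: MochizukiFrdI2008, Prop. 1.4 (i) p.25] -/
theorem isCoAngularPreStep_of_isotropic (hiso : IsOfIsotropicType F) {A B : C} {φ : A ⟶ B}
    (h : IsPreStep F φ) : IsCoAngularPreStep F φ :=
  ⟨isCoAngular_of_isIsotropic_codomains F φ fun X _ => hiso X, h⟩

/-- `0` is a birational germ at every object (`δ₁ = δ₂ = id`). [cite: MochizukiFrdI2008, Thm. 5.1 (i) p.97] -/
theorem one_mem_biratGerms (hiso : IsOfIsotropicType F) (A : C) :
    (1 : Algebra.GrothendieckGroup (Φ.obj (op (baseObj F A)))) ∈ biratGerms F A :=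
  ⟨A, 𝟙 A, 𝟙 A, isCoAngularPreStep_of_isotropic hiso (isPreStep_of_isIso F _),
    isPreStep_of_isIso F _, rfl, by rw [div_self']⟩

/-- Birational germs are stable under inversion (swap the pair). [cite: MochizukiFrdI2008, Thm. 5.1 (i) p.97] -/
theorem inv_mem_biratGerms (hiso : IsOfIsotropicType F) {A : C}
    {d : Algebra.GrothendieckGroup (Φ.obj (op (baseObj F A)))}
    (hd : d ∈ biratGerms F A) : d⁻¹ ∈ biratGerms F A := by
  obtain ⟨Y, δ₁, δ₂, h₁, h₂, hb, rfl⟩ := hd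
  exact ⟨Y, δ₂, δ₁, isCoAngularPreStep_of_isotropic hiso h₂, h₁.2, hb.symm, by rw [inv_div]⟩

/-- Birational germs at `A` are closed under products: two pairs of pre-steps into `A` admit a common
refinement (Definition 1.3 (iii)(d) in the slice over `A`), along which germs do not change, and the
refined pairs telescope. [cite: MochizukiFrdI2008, Thm. 5.1 (i) p.97] -/
theorem mul_mem_biratGerms (hF : IsFrobenioid F) (hiso : IsOfIsotropicType F) {A : C}
    {d d' : Algebra.GrothendieckGroup (Φ.obj (op (baseObj F A)))}
    (hd : d ∈ biratGerms F A) (hd' : d' ∈ biratGerms F A) : d * d' ∈ biratGerms F A := by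
  obtain ⟨Y, δ₁, δ₂, h₁, h₂, hb, rfl⟩ := hd
  obtain ⟨Y', δ₃, δ₄, h₃, h₄, hb', rfl⟩ := hd'
  -- a co-angular pre-step `ω : W → A` dominating `δ₂` and `δ₃`
  obtain ⟨W, ω, hω, hωdiv⟩ :=
    hF.iii_d_over_surj A (invDiv F δ₂ h₂.2 * invDiv F δ₃ h₃.2.2)
  obtain ⟨a₂, ha₂, ha₂ω⟩ := hF.iii_d_over_full ω δ₂ hω (isCoAngularPreStep_of_isotropic hiso h₂)
    (by rw [hωdiv]; exact dvd_mul_right _ _)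
  obtain ⟨a₃, ha₃, ha₃ω⟩ := hF.iii_d_over_full ω δ₃ hω h₃
    (by rw [hωdiv]; exact dvd_mul_left _ _)
  have hp₁ : IsPreStep F (a₂ ≫ δ₁) := IsPreStep.comp F ha₂.2 h₁.2
  have hp₂ : IsPreStep F (a₂ ≫ δ₂) := IsPreStep.comp F ha₂.2 h₂
  have hp₃ : IsPreStep F (a₃ ≫ δ₃) := IsPreStep.comp F ha₃.2 h₃.2
  have hp₄ : IsPreStep F (a₃ ≫ δ₄) := IsPreStep.comp F ha₃.2 h₄
  refine ⟨W, a₂ ≫ δ₁, a₃ ≫ δ₄, isCoAngularPreStep_of_isotropic hiso hp₁, hp₄, ?_, ?_⟩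
  · show Base F (a₂ ≫ δ₁) = Base F (a₃ ≫ δ₄)
    rw [base_comp, base_comp, show Base F δ₁ = Base F δ₂ from hb, ← base_comp, ha₂ω,
      ← show Base F δ₃ = Base F δ₄ from hb', ← base_comp, ha₃ω]
  · show _ = Algebra.GrothendieckGroup.of (invDiv F (a₂ ≫ δ₁) hp₁.2) /
        Algebra.GrothendieckGroup.of (invDiv F (a₃ ≫ δ₄) hp₄.2)
    rw [← germ_comp_eq F a₂ δ₁ δ₂ ha₂.2.2 h₁.2 h₂ hb hp₁.2 hp₂.2,
      ← germ_comp_eq F a₃ δ₃ δ₄ ha₃.2.2 h₃.2 h₄ hb' hp₃.2 hp₄.2,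
      RatFrac.invDiv_congr F ha₂ω hp₂.2 hω.2.2, RatFrac.invDiv_congr F ha₃ω hp₃.2 hω.2.2, div_mul_div_cancel]

/-! ### Lifting morphisms of `D` to pull-back morphisms (Definition 1.3 (i)(c)) -/

/-- Definition 1.3 (i)(c) (essential surjectivity of `C^pl-bk_{A'} → D_{A'_D}`): every morphism
`f : X → A'_D` of `D` is, up to an isomorphism `X ≅ Base(B)`, the projection of a pull-back morphism
`g : B → A'`. (Private copy; the public home of this lemma is abc-iut-L1-t1's
`IsometricPreStepsPullback.lean`, L1-lead ruling 2026-08-25T19:44Z.) [cite: MochizukiFrdI2008, Def. 1.3 (i) p.24] -/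
private theorem exists_isPullbackMorphism_over_t10 (hF : IsFrobenioid F) (A' : C) {X : D}
    (f : X ⟶ baseObj F A') :
    ∃ (B : C) (g : B ⟶ A') (ι : baseObj F B ≅ X), IsPullbackMorphism F g ∧ ι.hom ≫ f = Base F g := by
  haveI := hF.i_c A'
  let Y : Over ((wideSubcategoryInclusion (pullbackMorphisms F) ⋙ baseFunctor F).obj ⟨A'⟩) :=
    Over.mk f
  let P := (pullbackSliceToBase F A').objPreimage Y
  let e : (pullbackSliceToBase F A').obj P ≅ Y := (pullbackSliceToBase F A').objObjPreimageIso Y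
  refine ⟨P.left.obj, P.hom.hom, (Over.forget _).mapIso e, P.hom.property, ?_⟩
  have hw := Over.w e.hom
  exact hw

/-! ### Transport of germs along pull-back morphisms -/

/-- A germ at `A'` pulled back along the projection `Base(g)` of a pull-back morphism `g : B → A'` is a
germ at `B`: the pair of pre-steps is transported along `g` by the universal property of pull-back
morphisms (after moving its domain over `B_D` by Definition 1.3 (i)(c)); pull-back morphisms are linear
isometries (Definition 1.3 (iv)(b)), so divisors are simply pulled back.
[cite: MochizukiFrdI2008, Prop. 4.4 (iii) p.83] -/
theorem pullGp_mem_biratGerms_of_isPullbackMorphism (hF : IsFrobenioid F) (hiso : IsOfIsotropicType F)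
    {B A' : C} (g : B ⟶ A') (hg : IsPullbackMorphism F g)
    {d : Algebra.GrothendieckGroup (Φ.obj (op (baseObj F A')))}
    (hd : d ∈ biratGerms F A') : pullGp Φ (Base F g) d ∈ biratGerms F B := by
  obtain ⟨Y, δ₁, δ₂, h₁, h₂, hb, rfl⟩ := hd
  obtain ⟨⟨_, hgiso⟩, hglin⟩ := hF.iv_b g hg
  haveI : IsIso (Base F δ₁) := h₁.2.2
  obtain ⟨Y', h, κ, hh, hκ⟩ :=
    exists_isPullbackMorphism_over_t10 F hF Y (Base F g ≫ inv (Base F δ₁))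
  obtain ⟨⟨_, hhiso⟩, hhlin⟩ := hF.iv_b h hh
  have hcomp : ∀ {δ : Y ⟶ A'}, Base F δ = Base F δ₁ → Base F (h ≫ δ) = κ.hom ≫ Base F g := by
    intro δ hδ
    calc Base F (h ≫ δ) = Base F h ≫ Base F δ := base_comp F h δ
      _ = (κ.hom ≫ Base F g ≫ inv (Base F δ₁)) ≫ Base F δ₁ := by rw [hκ, hδ]
      _ = κ.hom ≫ Base F g := by
        simp only [Category.assoc, IsIso.inv_hom_id, Category.comp_id]
  obtain ⟨δ₁', hδ₁'⟩ := (hg Y').2 ⟨(h ≫ δ₁, κ.hom), hcomp rfl⟩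
  obtain ⟨δ₂', hδ₂'⟩ := (hg Y').2 ⟨(h ≫ δ₂, κ.hom), hcomp hb.symm⟩
  have e₁ : δ₁' ≫ g = h ≫ δ₁ := congrArg (fun p : PullbackHomData F g Y' => p.1.1) hδ₁'
  have b₁ : Base F δ₁' = κ.hom := congrArg (fun p : PullbackHomData F g Y' => p.1.2) hδ₁'
  have e₂ : δ₂' ≫ g = h ≫ δ₂ := congrArg (fun p : PullbackHomData F g Y' => p.1.1) hδ₂'
  have b₂ : Base F δ₂' = κ.hom := congrArg (fun p : PullbackHomData F g Y' => p.1.2) hδ₂'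
  -- the lifts are pre-steps
  have lin : ∀ {δ' : Y' ⟶ B} {δ : Y ⟶ A'}, δ' ≫ g = h ≫ δ → IsPreStep F δ → IsLinear F δ' := by
    intro δ' δ he hδ
    have hdeg := congrArg (degFr F) he
    rw [degFr_comp, degFr_comp, show degFr F g = 1 from hglin, show degFr F h = 1 from hhlin,
      show degFr F δ = 1 from hδ.1, mul_one, one_mul] at hdeg
    exact hdeg
  have hp₁ : IsPreStep F δ₁' := ⟨lin e₁ h₁.2, by rw [IsBaseIso, b₁]; infer_instance⟩
  have hp₂ : IsPreStep F δ₂' := ⟨lin e₂ h₂, by rw [IsBaseIso, b₂]; infer_instance⟩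
  -- divisors of the lifts
  have hdiv : ∀ {δ' : Y' ⟶ B} {δ : Y ⟶ A'}, δ' ≫ g = h ≫ δ → IsPreStep F δ →
      Div F δ' = pull Φ (Base F h) (Div F δ) := by
    intro δ' δ he hδ
    have hD := congrArg (Div F) he
    rw [div_comp, div_comp, show Div F g = 1 from hgiso, map_one, one_mul,
      degFr_coe_eq_one F hglin, pow_one, show Div F h = 1 from hhiso, one_pow, mul_one] at hD
    exact hD
  -- the germs correspond
  have hinv : ∀ {δ' : Y' ⟶ B} {δ : Y ⟶ A'} (_ : δ' ≫ g = h ≫ δ) (hδ : IsPreStep F δ)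
      (hδ' : IsPreStep F δ'), invDiv F δ' hδ'.2 = pull Φ (Base F g) (invDiv F δ hδ.2) := by
    intro δ' δ he hδ hδ'
    haveI : IsIso (Base F δ') := hδ'.2
    haveI : IsIso (Base F δ) := hδ.2
    apply pull_injective (Base F δ')
    have hbase : Base F δ' ≫ Base F g = Base F h ≫ Base F δ := by
      rw [← base_comp, he, base_comp]
    rw [pull_invDiv, hdiv he hδ, ← pull_comp, hbase, pull_comp, pull_invDiv]
  refine ⟨Y', δ₁', δ₂', isCoAngularPreStep_of_isotropic hiso hp₁, hp₂, b₁.trans b₂.symm, ?_⟩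
  show _ = Algebra.GrothendieckGroup.of (invDiv F δ₁' hp₁.2) /
      Algebra.GrothendieckGroup.of (invDiv F δ₂' hp₂.2)
  rw [map_div, pullGp_of', pullGp_of', hinv e₁ h₁.2 hp₁, hinv e₂ h₂ hp₂]

/-! ### Transport of germs between base-isomorphic objects -/

/-- A germ at `B` pulled back along an isomorphism `θ : A_D ⥲ B_D` of `D` is a germ at `A`: realise
`θ` by a pair of pre-steps `φ : X → A`, `ψ : X → B` (Definition 1.3 (i)(b)), refine the pair at `B`
together with `ψ` (Definition 1.3 (iii)(d) over `B`), and push the refined pair down to `X` and then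
to `A`. [cite: MochizukiFrdI2008, Prop. 4.4 (iii) p.83] -/
theorem pullGp_mem_biratGerms_of_iso (hF : IsFrobenioid F) (hiso : IsOfIsotropicType F) {A B : C}
    (θ : baseObj F A ≅ baseObj F B) {d : Algebra.GrothendieckGroup (Φ.obj (op (baseObj F B)))}
    (hd : d ∈ biratGerms F B) : pullGp Φ θ.hom d ∈ biratGerms F A := by
  obtain ⟨Y, δ₁, δ₂, h₁, h₂, hb, rfl⟩ := hd
  obtain ⟨X, φ, ψ, hφ, hψ, hθ⟩ := hF.i_b A B θ
  haveI : IsIso (Base F ψ) := hψ.2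
  haveI : IsIso (Base F φ) := hφ.2
  haveI : IsIso (Base F δ₁) := h₁.2.2
  haveI : IsCancelMul (Φ.obj (op (baseObj F Y))) := isIntegral_iff_isCancelMul.mp
    (hF.isPreFrobenioid.isDivisorial (baseObj F Y)).isPreDivisorial.isIntegral
  -- dominate `δ₁` and `ψ` over `B`
  obtain ⟨W, ω, hω, hωdiv⟩ :=
    hF.iii_d_over_surj B (invDiv F δ₁ h₁.2.2 * (invDiv F δ₂ h₂.2 * invDiv F ψ hψ.2))
  obtain ⟨a₁, ha₁, ha₁ω⟩ := hF.iii_d_over_full ω δ₁ hω h₁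
    (by rw [hωdiv]; exact dvd_mul_right _ _)
  obtain ⟨c, hc, hcω⟩ := hF.iii_d_over_full ω ψ hω (isCoAngularPreStep_of_isotropic hiso hψ)
    (by rw [hωdiv]; exact (dvd_mul_left _ _).mul_left _)
  have hp₂ : IsPreStep F (a₁ ≫ δ₂) := IsPreStep.comp F ha₁.2 h₂
  have hp₁ : IsPreStep F (a₁ ≫ δ₁) := IsPreStep.comp F ha₁.2 h₁.2
  -- `Φ(a₁)⁻¹ Div(a₁)` transported to `B`
  have hs : invDiv F a₁ ha₁.2.2 = pull Φ (Base F δ₁) (invDiv F δ₂ h₂.2 * invDiv F ψ hψ.2) := by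
    have e := pull_invDiv_comp F a₁ δ₁ ha₁.2.2 h₁.2 hp₁.2
    rw [RatFrac.invDiv_congr F ha₁ω hp₁.2 hω.2.2, hωdiv, map_mul, pull_invDiv] at e
    exact (mul_left_cancel e).symm
  have hdiv₂ : invDiv F (a₁ ≫ δ₂) hp₂.2 = invDiv F δ₂ h₂.2 * (invDiv F δ₂ h₂.2 * invDiv F ψ hψ.2) := by
    haveI : IsIso (Base F δ₂) := h₂.2
    apply pull_injective (Base F δ₂)
    rw [pull_invDiv_comp F a₁ δ₂ ha₁.2.2 h₂ hp₂.2, hs, show Base F δ₁ = Base F δ₂ from hb]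
    simp only [map_mul, pull_invDiv]
  obtain ⟨c₂, hc₂, hc₂ω⟩ := hF.iii_d_over_full (a₁ ≫ δ₂) ψ (isCoAngularPreStep_of_isotropic hiso hp₂)
    (isCoAngularPreStep_of_isotropic hiso hψ)
    (by
      show invDiv F ψ hψ.2 ∣ invDiv F (a₁ ≫ δ₂) hp₂.2
      rw [hdiv₂]; exact (dvd_mul_left _ _).mul_left _)
  -- the pair `(c ≫ φ, c₂ ≫ φ)` at `A`
  have hq₁ : IsPreStep F (c ≫ φ) := IsPreStep.comp F hc.2 hφ
  have hq₂ : IsPreStep F (c₂ ≫ φ) := IsPreStep.comp F hc₂.2 hφ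
  have hbc : Base F c = Base F c₂ := by
    have e1 : Base F c ≫ Base F ψ = Base F ω := by rw [← base_comp, hcω]
    have e2 : Base F c₂ ≫ Base F ψ = Base F ω := by
      rw [← base_comp, hc₂ω, base_comp, ← show Base F δ₁ = Base F δ₂ from hb, ← base_comp, ha₁ω]
    exact (cancel_mono (Base F ψ)).mp (e1.trans e2.symm)
  -- divisor identities through `ψ`
  have k₁ : pull Φ (inv (Base F ψ)) (invDiv F c hc.2.2) * invDiv F ψ hψ.2 = invDiv F ω hω.2.2 := by
    apply pull_injective (Base F ψ)
    rw [map_mul, pull_pull_inv_eq, pull_invDiv, mul_comm,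
      ← pull_invDiv_comp F c ψ hc.2.2 hψ (IsBaseIso.comp F hc.2.2 hψ.2),
      RatFrac.invDiv_congr F hcω (IsBaseIso.comp F hc.2.2 hψ.2) hω.2.2]
  have k₂ : pull Φ (inv (Base F ψ)) (invDiv F c₂ hc₂.2.2) * invDiv F ψ hψ.2 =
      invDiv F (a₁ ≫ δ₂) hp₂.2 := by
    apply pull_injective (Base F ψ)
    rw [map_mul, pull_pull_inv_eq, pull_invDiv, mul_comm,
      ← pull_invDiv_comp F c₂ ψ hc₂.2.2 hψ (IsBaseIso.comp F hc₂.2.2 hψ.2),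
      RatFrac.invDiv_congr F hc₂ω (IsBaseIso.comp F hc₂.2.2 hψ.2) hp₂.2]
  have hg : Algebra.GrothendieckGroup.of (invDiv F δ₁ h₁.2.2) /
        Algebra.GrothendieckGroup.of (invDiv F δ₂ h₂.2) =
      pullGp Φ (inv (Base F ψ)) (Algebra.GrothendieckGroup.of (invDiv F c hc.2.2) /
        Algebra.GrothendieckGroup.of (invDiv F c₂ hc₂.2.2)) := by
    rw [← germ_comp_eq F a₁ δ₁ δ₂ ha₁.2.2 h₁.2 h₂ hb hp₁.2 hp₂.2,
      RatFrac.invDiv_congr F ha₁ω hp₁.2 hω.2.2, ← k₁, ← k₂, map_div, pullGp_of', pullGp_of', map_mul, map_mul,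
      mul_div_mul_right_eq_div]
  refine ⟨W, c ≫ φ, c₂ ≫ φ, isCoAngularPreStep_of_isotropic hiso hq₁, hq₂, ?_, ?_⟩
  · show Base F (c ≫ φ) = Base F (c₂ ≫ φ)
    rw [base_comp, base_comp, hbc]
  show _ = Algebra.GrothendieckGroup.of (invDiv F (c ≫ φ) hq₁.2) /
      Algebra.GrothendieckGroup.of (invDiv F (c₂ ≫ φ) hq₂.2)
  apply pullGp_injective (Base F φ)
  rw [← pullGp_comp, hθ]
  conv_rhs => rw [map_div, pullGp_of', pullGp_of', pull_invDiv_comp F c φ hc.2.2 hφ hq₁.2,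
    pull_invDiv_comp F c₂ φ hc₂.2.2 hφ hq₂.2, map_mul, map_mul, mul_div_mul_left_eq_div]
  rw [hg, pullGp_pullGp_inv]

/-! ### `Φ^birat(A_D)` consists of germs -/

/-- Every generator of `Φ^birat(A_D)` — a germ at some `A'` pulled back along some `f : A_D → A'_D` —
is a germ at `A` (lift `f` by Definition 1.3 (i)(c) and apply the two transport lemmas).
[cite: MochizukiFrdI2008, Prop. 4.4 (iii) p.83] -/
theorem biratGenerators_subset_biratGerms (hF : IsFrobenioid F) (hiso : IsOfIsotropicType F) (A : C) :
    biratGenerators F (baseObj F A) ⊆ biratGerms F A := by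
  rintro _ ⟨A', f, d, hd, rfl⟩
  obtain ⟨B, g, ι, hg, hι⟩ := exists_isPullbackMorphism_over_t10 F hF A' f
  have hf : f = ι.inv ≫ Base F g := by rw [← hι, ι.inv_hom_id_assoc]
  rw [hf, pullGp_comp]
  exact pullGp_mem_biratGerms_of_iso F hF hiso ι.symm
    (pullGp_mem_biratGerms_of_isPullbackMorphism F hF hiso g hg hd)

/-- **`Φ^birat(A_D)` is the set of birational germs at `A`** (FrdI Prop. 4.4 (iii)/(iv) p. 83 for the
concrete subfunctor of `BiratSubfunctor.lean`; the reading of `Φ^birat(A)` used in the proof of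
Thm. 5.1 (i), p. 97 ll. 41–44), for a Frobenioid of isotropic type: membership in the generated
subgroup implies being a single germ. [cite: MochizukiFrdI2008, Prop. 4.4 (iii) p.83] -/
theorem mem_biratGerms_of_mem_biratSubfunctor (hF : IsFrobenioid F) (hiso : IsOfIsotropicType F)
    {A : C} {c : Algebra.GrothendieckGroup (Φ.obj (op (baseObj F A)))}
    (hc : c ∈ (biratSubfunctor F).carrier (baseObj F A)) : c ∈ biratGerms F A := by
  rw [biratSubfunctor_carrier] at hc
  induction hc using Subgroup.closure_induction with
  | mem x hx => exact biratGenerators_subset_biratGerms F hF hiso A hx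
  | one => exact one_mem_biratGerms F hiso A
  | mul x y _ _ hx hy => exact mul_mem_biratGerms F hF hiso hx hy
  | inv x _ hx => exact inv_mem_biratGerms F hiso hx

/-- `Φ^birat(A_D)` equals the set of birational germs at `A` (Frobenioid of isotropic type).
[cite: MochizukiFrdI2008, Prop. 4.4 (iii) p.83] -/
theorem coe_biratSubfunctor_baseObj (hF : IsFrobenioid F) (hiso : IsOfIsotropicType F) (A : C) :
    ((biratSubfunctor F).carrier (baseObj F A) : Set _) = biratGerms F A :=
  Set.Subset.antisymm (fun _ hc => mem_biratGerms_of_mem_biratSubfunctor F hF hiso hc)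
    fun _ hd => mem_biratSubfunctor_of_mem_biratGerms F hd

end PreFrobenioid

end Literature.AlgebraicGeometry.Frobenioids
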